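import Summits.QuantumFields.QCD.Theorems.NestedDissectionSeaCoerciveSeaPropagatorLaw

/-!
# Crux `CoerciveSea` (stmt-QuantumFields-13901) — the crux's own event is MEASURABLE, and its
# phase-quenched probability is monotone in the level

Helper file of line lead c5, line `chirality-collapses-pseudospectrum`. Clause (i) of the crux and the line's one open
internal stub `stub_separatorLawLarge` speak about the phase-quenched ratio
`P(E) = ∫ 1_E · wt dμ_W / ∫ wt dμ_W` of the event `E = {U | HasSingularSeparator U μ s τ}` (a vector harmonic on the
children interiors, non-zero on the internal separator `Σ`, with separator residual `< τ² ×` its separator mass). With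
Bochner conventions `P(E)` is the junk value `0` when `1_E · wt` is not a.e.-strongly measurable, so every honest use of
the ratio (monotonicity, union bounds, comparison with a cover) needs `E` to be a measurable set of gauge fields. Lead c4
obtained measurability only for the PROPAGATOR cover `det D_c = 0 ∨ ‖(D_c⁻¹)_ΣΣ‖ > 1/τ`
(`measurableSet_compressedInverseEvent`); this file proves it for the crux's event itself:

* `hasSingularSeparator_iff_exists_harmonic` — the non-vanishing conjunct of `HasSingularSeparator` is implied by the
  strict residual inequality (a vector vanishing on `Σ` has separator mass `0`), so the event is
  `∃ w, (harmonic inside) ∧ (residual < τ² · mass)`: a CLOSED condition and ONE STRICT inequality between continuous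
  functions of `(U, w)`;
* `isSigmaCompact_separatorFamilies` — that subset of `GaugeConfig × (box → ℂ)` is σ-compact
  (`CensusDominates.isSigmaCompact_inter_lt`);
* `measurableSet_hasSingularSeparator` — its first projection, the crux's event, is σ-compact, hence MEASURABLE in the
  compact Hausdorff Borel space of `SU(3)` gauge fields;
* `separatorRatio_mono` — the crux's ratio `P(HasSingularSeparator · μ s τ)` is monotone in the level on `[0, ∞)`
  (`HasSingularSeparator.mono` + `ratio_mono`), and `separatorRatio_le_of_cover` — it is dominated by the ratio of any
  measurable cover and dominates the ratio of any sub-event (the two directions a Wegner-type proof of the law uses).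

No new definitions. [folklore]
-/

noncomputable section

open scoped BigOperators Classical
open MeasureTheory Filter Matrix
open Literature.MathematicalPhysics.QuantumLattice Literature.MathematicalPhysics.QuantumFieldTheory
  Literature.Probability.LatticeModels
open Summit.QuantumFields.QCD.Cruxes.CoerciveSea.ChiralityCollapsesPseudospectrum.CensusDominates
  (isSigmaCompact_inter_lt measurableSet_of_isSigmaCompact mem_image_fst continuous_wilsonCell)

namespace Summit.QuantumFields.QCD.Theorems.NestedDissectionSeaCoerciveSea

variable {N : ℕ} [NeZero N]

/-- **The non-vanishing conjunct is redundant.** `HasSingularSeparator U μ s τ` holds iff some vector on the box is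
harmonic on the children interiors and has separator residual `< τ² ×` its separator mass: a vector vanishing on the
separator has separator mass `0`, and no non-negative residual is `< τ² · 0`. [folklore] -/
theorem hasSingularSeparator_iff_exists_harmonic (U : GaugeConfig 4 N (Matrix.specialUnitaryGroup (Fin 3) ℂ)) (μ : ℝ) (s : Fin 4 → ℕ) (τ : ℝ) :
    HasSingularSeparator U μ s τ ↔
      ∃ w : {p // wilsonBox (0 : TorusSite 4 N) s p} → ℂ,
        (∀ p, childrenInterior s p → (wilsonCell U μ 0 s).mulVec w p = 0) ∧
        ∑ p, (if childrenInterior s p then 0 else ‖(wilsonCell U μ 0 s).mulVec w p‖ ^ 2) <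
          τ ^ 2 * ∑ p, (if childrenInterior s p then 0 else ‖w p‖ ^ 2) := by
  constructor
  · rintro ⟨w, -, hharm, hres⟩
    exact ⟨w, hharm, hres⟩
  · rintro ⟨w, hharm, hres⟩
    refine ⟨w, ?_, hharm, hres⟩
    by_contra hzero
    push Not at hzero
    have hmass : ∑ p, (if childrenInterior s p then 0 else ‖w p‖ ^ 2) = (0 : ℝ) := by
      refine Finset.sum_eq_zero fun p _ => ?_
      split_ifs with hp
      · rfl
      · rw [hzero p hp, norm_zero, zero_pow two_ne_zero]
    have hnonneg : (0 : ℝ) ≤ ∑ p, (if childrenInterior s p then 0 else ‖(wilsonCell U μ 0 s).mulVec w p‖ ^ 2) :=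
      Finset.sum_nonneg fun p _ => by split_ifs <;> positivity
    rw [hmass, mul_zero] at hres
    exact absurd hres (not_lt.2 hnonneg)

/-- The families `(U, w)` with `w` harmonic on the children interiors and separator residual `< τ² ×` separator mass form
a σ-compact subset of `GaugeConfig × (box → ℂ)`: a closed set (the harmonic equations are continuous in `(U, w)`,
`continuous_wilsonCell`) cut by one strict inequality between continuous functions. [folklore] -/
theorem isSigmaCompact_separatorFamilies (μ : ℝ) (s : Fin 4 → ℕ) (τ : ℝ) :
    IsSigmaCompact {x : GaugeConfig 4 N (Matrix.specialUnitaryGroup (Fin 3) ℂ) × ({p // wilsonBox (0 : TorusSite 4 N) s p} → ℂ) |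
      (∀ p, childrenInterior s p → (wilsonCell x.1 μ 0 s).mulVec x.2 p = 0) ∧
      ∑ p, (if childrenInterior s p then 0 else ‖(wilsonCell x.1 μ 0 s).mulVec x.2 p‖ ^ 2) <
        τ ^ 2 * ∑ p, (if childrenInterior s p then 0 else ‖x.2 p‖ ^ 2)} := by
  have hw : ∀ p : {p // wilsonBox (0 : TorusSite 4 N) s p},
      Continuous fun x : GaugeConfig 4 N (Matrix.specialUnitaryGroup (Fin 3) ℂ) × ({p // wilsonBox (0 : TorusSite 4 N) s p} → ℂ) => x.2 p :=
    fun p => by fun_prop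
  have hDw : Continuous fun x : GaugeConfig 4 N (Matrix.specialUnitaryGroup (Fin 3) ℂ) × ({p // wilsonBox (0 : TorusSite 4 N) s p} → ℂ) =>
      (wilsonCell x.1 μ 0 s).mulVec x.2 :=
    ((continuous_wilsonCell μ 0 s).comp continuous_fst).matrix_mulVec continuous_snd
  have hDwp : ∀ p : {p // wilsonBox (0 : TorusSite 4 N) s p},
      Continuous fun x : GaugeConfig 4 N (Matrix.specialUnitaryGroup (Fin 3) ℂ) × ({p // wilsonBox (0 : TorusSite 4 N) s p} → ℂ) =>
        (wilsonCell x.1 μ 0 s).mulVec x.2 p :=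
    fun p => (continuous_apply p).comp hDw
  have hclosed : IsClosed {x : GaugeConfig 4 N (Matrix.specialUnitaryGroup (Fin 3) ℂ) × ({p // wilsonBox (0 : TorusSite 4 N) s p} → ℂ) |
      ∀ p, childrenInterior s p → (wilsonCell x.1 μ 0 s).mulVec x.2 p = 0} := by
    simp only [Set.setOf_forall]
    exact isClosed_iInter fun p => isClosed_iInter fun _ => isClosed_eq (hDwp p) continuous_const
  rw [Set.setOf_and]
  exact isSigmaCompact_inter_lt (isSigmaCompact_univ.of_isClosed_subset hclosed (Set.subset_univ _))
    (continuous_finsetSum _ fun p _ => Continuous.if_const _ continuous_const ((hDwp p).norm.pow 2))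
    (continuous_const.mul
      (continuous_finsetSum _ fun p _ => Continuous.if_const _ continuous_const ((hw p).norm.pow 2)))

/-- **The crux's event is measurable.** For every torus side, mass, box and level, the set of `SU(3)` gauge fields with a
`τ`-singular internal separator of the corner-`0` box of sides `s`, `{U | HasSingularSeparator U μ s τ}`, is a measurable
set: it is the first projection of the σ-compact family set (`isSigmaCompact_separatorFamilies`), hence σ-compact in the
Hausdorff Borel space of gauge fields. [folklore] -/
theorem measurableSet_hasSingularSeparator :
    ∀ (N : ℕ) [NeZero N] (μ : ℝ) (s : Fin 4 → ℕ) (τ : ℝ),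
      MeasurableSet {U : GaugeConfig 4 N (Matrix.specialUnitaryGroup (Fin 3) ℂ) | HasSingularSeparator U μ s τ} := by
  intro N _ μ s τ
  have hset : {U : GaugeConfig 4 N (Matrix.specialUnitaryGroup (Fin 3) ℂ) | HasSingularSeparator U μ s τ} =
      Prod.fst '' {x : GaugeConfig 4 N (Matrix.specialUnitaryGroup (Fin 3) ℂ) × ({p // wilsonBox (0 : TorusSite 4 N) s p} → ℂ) |
        (∀ p, childrenInterior s p → (wilsonCell x.1 μ 0 s).mulVec x.2 p = 0) ∧
        ∑ p, (if childrenInterior s p then 0 else ‖(wilsonCell x.1 μ 0 s).mulVec x.2 p‖ ^ 2) <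
          τ ^ 2 * ∑ p, (if childrenInterior s p then 0 else ‖x.2 p‖ ^ 2)} := by
    ext U
    simp only [Set.mem_setOf_eq, mem_image_fst, hasSingularSeparator_iff_exists_harmonic]
  rw [hset]
  exact measurableSet_of_isSigmaCompact ((isSigmaCompact_separatorFamilies μ s τ).image continuous_fst)

/-- **The crux's ratio is dominated by the ratio of any measurable cover and dominates the ratio of any sub-event.**
For the phase-quenched weight `wt = ∏_f ‖det D_W(U, m_f, 1)‖` against the Wilson measure at coupling `β`: if
`E ⊆ {HasSingularSeparator · μ s τ} ⊆ F` with `F` measurable, then `P(E) ≤ P(HasSingularSeparator · μ s τ) ≤ P(F)`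
(Bochner conventions; the middle event is measurable by `measurableSet_hasSingularSeparator`). [folklore] -/
theorem separatorRatio_le_of_cover {Nf : ℕ} (β : ℝ) (mq : Fin Nf → ℝ) (μ : ℝ) (s : Fin 4 → ℕ) (τ : ℝ)
    (E F : GaugeConfig 4 N (Matrix.specialUnitaryGroup (Fin 3) ℂ) → Prop) (hE : ∀ U, E U → HasSingularSeparator U μ s τ)
    (hF : MeasurableSet {U | F U}) (hEF : ∀ U, HasSingularSeparator U μ s τ → F U) :
    (∫ U, (if E U then (1 : ℝ) else 0) * ∏ f, ‖fermionDet (wilsonDirac (fundamentalRep (Fin 3)) U (mq f) 1)‖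
        ∂(wilsonMeasure (d := 4) (L := N) (fundamentalRep (Fin 3)) β)) /
      (∫ U, ∏ f, ‖fermionDet (wilsonDirac (fundamentalRep (Fin 3)) U (mq f) 1)‖
        ∂(wilsonMeasure (d := 4) (L := N) (fundamentalRep (Fin 3)) β)) ≤
    (∫ U, (if HasSingularSeparator U μ s τ then (1 : ℝ) else 0) *
          ∏ f, ‖fermionDet (wilsonDirac (fundamentalRep (Fin 3)) U (mq f) 1)‖
        ∂(wilsonMeasure (d := 4) (L := N) (fundamentalRep (Fin 3)) β)) /
      (∫ U, ∏ f, ‖fermionDet (wilsonDirac (fundamentalRep (Fin 3)) U (mq f) 1)‖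
        ∂(wilsonMeasure (d := 4) (L := N) (fundamentalRep (Fin 3)) β)) ∧
    (∫ U, (if HasSingularSeparator U μ s τ then (1 : ℝ) else 0) *
          ∏ f, ‖fermionDet (wilsonDirac (fundamentalRep (Fin 3)) U (mq f) 1)‖
        ∂(wilsonMeasure (d := 4) (L := N) (fundamentalRep (Fin 3)) β)) /
      (∫ U, ∏ f, ‖fermionDet (wilsonDirac (fundamentalRep (Fin 3)) U (mq f) 1)‖
        ∂(wilsonMeasure (d := 4) (L := N) (fundamentalRep (Fin 3)) β)) ≤
    (∫ U, (if F U then (1 : ℝ) else 0) * ∏ f, ‖fermionDet (wilsonDirac (fundamentalRep (Fin 3)) U (mq f) 1)‖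
        ∂(wilsonMeasure (d := 4) (L := N) (fundamentalRep (Fin 3)) β)) /
      (∫ U, ∏ f, ‖fermionDet (wilsonDirac (fundamentalRep (Fin 3)) U (mq f) 1)‖
        ∂(wilsonMeasure (d := 4) (L := N) (fundamentalRep (Fin 3)) β)) := by
  have hwt0 : ∀ U : GaugeConfig 4 N (Matrix.specialUnitaryGroup (Fin 3) ℂ), 0 ≤ ∏ f, ‖fermionDet (wilsonDirac (fundamentalRep (Fin 3)) U (mq f) 1)‖ :=
    fun U => Finset.prod_nonneg fun f _ => norm_nonneg _
  have hwtm : Measurable fun U : GaugeConfig 4 N (Matrix.specialUnitaryGroup (Fin 3) ℂ) =>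
      ∏ f, ‖fermionDet (wilsonDirac (fundamentalRep (Fin 3)) U (mq f) 1)‖ := by
    simpa only [norm_det_diracMatrix] using measurable_norm_det_diracMatrix (S := N) mq
  have hwti : Integrable (fun U : GaugeConfig 4 N (Matrix.specialUnitaryGroup (Fin 3) ℂ) =>
      ∏ f, ‖fermionDet (wilsonDirac (fundamentalRep (Fin 3)) U (mq f) 1)‖)
      (wilsonMeasure (d := 4) (L := N) (fundamentalRep (Fin 3)) β) := by
    simpa only [norm_det_diracMatrix] using
      integrable_norm_det_diracMatrix (S := N) mq (wilsonMeasure (d := 4) (L := N) (fundamentalRep (Fin 3)) β)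
  exact ⟨ratio_mono _ _ hwt0 hwtm hwti E _ (measurableSet_hasSingularSeparator N μ s τ) hE,
    ratio_mono _ _ hwt0 hwtm hwti _ F hF hEF⟩

/-- **The crux's ratio is monotone in the level.** For `0 ≤ τ ≤ τ'` the phase-quenched probability of a `τ`-singular
separator is at most that of a `τ'`-singular one (`HasSingularSeparator.mono`, measurability of the larger event,
`ratio_mono`). In particular a bound `P(· at level τ') ≤ C t^α` propagates to every lower level. [folklore] -/
theorem separatorRatio_mono {Nf : ℕ} (β : ℝ) (mq : Fin Nf → ℝ) (μ : ℝ) (s : Fin 4 → ℕ) {τ τ' : ℝ}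
    (hτ : 0 ≤ τ) (hττ' : τ ≤ τ') :
    (∫ U, (if HasSingularSeparator U μ s τ then (1 : ℝ) else 0) *
          ∏ f, ‖fermionDet (wilsonDirac (fundamentalRep (Fin 3)) U (mq f) 1)‖
        ∂(wilsonMeasure (d := 4) (L := N) (fundamentalRep (Fin 3)) β)) /
      (∫ U, ∏ f, ‖fermionDet (wilsonDirac (fundamentalRep (Fin 3)) U (mq f) 1)‖
        ∂(wilsonMeasure (d := 4) (L := N) (fundamentalRep (Fin 3)) β)) ≤
    (∫ U, (if HasSingularSeparator U μ s τ' then (1 : ℝ) else 0) *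
          ∏ f, ‖fermionDet (wilsonDirac (fundamentalRep (Fin 3)) U (mq f) 1)‖
        ∂(wilsonMeasure (d := 4) (L := N) (fundamentalRep (Fin 3)) β)) /
      (∫ U, ∏ f, ‖fermionDet (wilsonDirac (fundamentalRep (Fin 3)) U (mq f) 1)‖
        ∂(wilsonMeasure (d := 4) (L := N) (fundamentalRep (Fin 3)) β)) :=
  (separatorRatio_le_of_cover β mq μ s τ' (fun U => HasSingularSeparator U μ s τ) (fun U => HasSingularSeparator U μ s τ')
    (fun _ h => h.mono hτ hττ') (measurableSet_hasSingularSeparator N μ s τ') (fun _ h => h)).1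

end Summit.QuantumFields.QCD.Theorems.NestedDissectionSeaCoerciveSea

end
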